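import Literature.Analysis.FluidPDE.CompressibleEulerImplosionOriginGermWindow2
import Literature.Analysis.FluidPDE.CompressibleEulerImplosionGraphBarrier
import Literature.Analysis.FluidPDE.CompressibleEulerImplosionShooting
import HarnessLib

/-!
# Buckmaster–Cao-Labora–Gómez-Serrano at `γ = 5/3`: an upper bound for the arrival time of the `P₀` trajectory (window 2)

Companion of `…Shooting` (the `P₀` trajectory `traj r`, its arrival time `bT r` at `P_s`) and of the certified centre
series on the shooting window `r ∈ [13890041/12500000, 697/625]` (`…OriginGermWindow2`: the trajectory is the origin germ up to
`e^ξ = 17/50`, where `D_Z < 0 < D_W`). Result `bT_le_window2`: `bT r ≤ log(1/3) + 137/430`, i.e. the sonic scale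
`c = e^{bT r}` of the pinned profile of the crux `DenseExcursion` (line `sonic-cavity-renewal`) is `≤ 0.4584 < 23/50`
(measured `c ∈ [0.4281, 0.4332]`). Proof (a phase-plane time estimate):

1. at `ξ₁ = log(1/3)` the trajectory is the germ: `W₁ = 3𝒲(1/3) ≤ 147/50` and `Z₁ ≥ β(W₁)` for the line
   `β(w) = −227/250 − (4/5)w` (two linear functionals of the certified coefficients `w₂, …, w₁₉` + majorant tails,
   `W1_le`, `line_le_Z1`);
2. the line is a LOWER BARRIER on the strip `9/4 < w < 59/20` (`gfun_line_neg`: the crossing quantity is `< 0`, `nlinarith`),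
   so `Z ≥ β(W)` on `[ξ₁, bT)` (`graph_le_snd_of_barrier_strip`, the smooth case of `…GraphBarrier`, with an upper `w`-bound);
3. on the region `β(w) ≤ Z ≤ −(3+w)/2`, `9/4 ≤ w ≤ 147/50` the speed is `−W′ = −N_W/D_W ≥ 43/20` (`speed_region`: concavity in `Z`
   + two `nlinarith` endpoint checks), hence by the mean value theorem `bT − ξ₁ ≤ (147/50 − 451/200)/(43/20) = 137/430`
   (`W > W₀(r) ≥ 451/200` along the trajectory).

[cite: BuckmasterCaolaboraGomezserrano2025, Prop. 2.5, Prop. 4.1, §6]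
-/

noncomputable section

open Filter Topology Set

namespace Literature.Analysis.FluidPDE

namespace BuckmasterCaolaboraGomezserrano2025

namespace OriginSeries

namespace CentreW2

set_option linter.style.longLine false
set_option linter.style.setOption false
set_option maxRecDepth 100000
set_option maxHeartbeats 4000000

/-! ### Linear functionals of the head coefficients: certified ranges -/

/-- Lower value of `Σ_{k<20} κ_k w_k` from the certified coefficient ranges. [folklore] -/
def lowQ (κ : ℕ → ℚ) : ℚ := sumQ (fun k => min (κ k * (bndsW2.getD k (0, 0)).1) (κ k * (bndsW2.getD k (0, 0)).2)) 20

/-- Upper value of `Σ_{k<20} κ_k w_k` from the certified coefficient ranges. [folklore] -/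
def highQ (κ : ℕ → ℚ) : ℚ := sumQ (fun k => max (κ k * (bndsW2.getD k (0, 0)).1) (κ k * (bndsW2.getD k (0, 0)).2)) 20

variable {r : ℝ}

/-- `lowQ κ ≤ Σ_{k<20} κ_k w_k(r) ≤ highQ κ` on the window. [cite: BuckmasterCaolaboraGomezserrano2025, App. B] -/
theorem head_functional_bounds (hr : r ∈ Set.Icc ((13890041/12500000 : ℚ) : ℝ) ((697/625 : ℚ) : ℝ)) (κ : ℕ → ℚ) :
    ((lowQ κ : ℚ) : ℝ) ≤ ∑ k ∈ Finset.range 20, ((κ k : ℚ) : ℝ) * w r 1 k ∧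
    ∑ k ∈ Finset.range 20, ((κ k : ℚ) : ℝ) * w r 1 k ≤ ((highQ κ : ℚ) : ℝ) := by
  unfold lowQ highQ
  rw [sumQ_cast, sumQ_cast]
  constructor
  · refine Finset.sum_le_sum fun k hk => ?_
    rw [Finset.mem_range] at hk
    obtain ⟨hlo, hhi⟩ := centre_coeff_boundsW2 hr (i := k) (by omega)
    push_cast
    rcases le_or_gt 0 ((κ k : ℚ) : ℝ) with h0 | h0
    · exact (min_le_left _ _).trans (mul_le_mul_of_nonneg_left hlo h0)
    · exact (min_le_right _ _).trans (mul_le_mul_of_nonpos_left hhi h0.le)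
  · refine Finset.sum_le_sum fun k hk => ?_
    rw [Finset.mem_range] at hk
    obtain ⟨hlo, hhi⟩ := centre_coeff_boundsW2 hr (i := k) (by omega)
    push_cast
    rcases le_or_gt 0 ((κ k : ℚ) : ℝ) with h0 | h0
    · exact (mul_le_mul_of_nonneg_left hhi h0).trans (le_max_right _ _)
    · exact (mul_le_mul_of_nonpos_left hlo h0.le).trans (le_max_left _ _)

/-- Coefficients of `W₁ = 3𝒲(1/3) = Σ 3·3^{−k} w_k`. [folklore] -/
def kap1 (k : ℕ) : ℚ := 3 * (1 / 3) ^ k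

/-- Coefficients of `2.4𝒲(1/3) − 3𝒲(−1/3) = Σ 3^{−k}(12/5 − 3(−1)^k) w_k`. [folklore] -/
def kap2 (k : ℕ) : ℚ := (12 / 5 - 3 * (-1) ^ k) * (1 / 3) ^ k

/-- The two certified head values: `highQ kap1 ≤ 147/50 − 10⁻⁴`, `lowQ kap2 + 227/250 ≥ 3/100 + 10⁻⁴`. [folklore] -/
theorem functionals_ok : highQ kap1 + 1 / 10000 ≤ 147 / 50 ∧ 3 / 100 + 1 / 10000 ≤ lowQ kap2 + 227 / 250 := by
  constructor <;> decide +kernel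

/-- **`W₁ = 3𝒲(1/3) ≤ 147/50`** on the window. [cite: BuckmasterCaolaboraGomezserrano2025, Prop. 2.5, App. B] -/
theorem W1_le (hr : r ∈ Set.Icc ((13890041/12500000 : ℚ) : ℝ) ((697/625 : ℚ) : ℝ)) :
    3 * profile r 1 (1 / 3) ≤ 147 / 50 := by
  have hμ : (0 : ℝ) < 73 / 25 := by norm_num
  have hKw := abs_w_le_one_mul_pow hr
  have hζ : (73 / 25 : ℝ) * |(1 / 3 : ℝ)| < 1 := by rw [abs_of_pos (by norm_num)]; norm_num
  have hP := (hasSum_profile_of_bound hμ hKw hζ).mul_left 3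
  set f : ℕ → ℝ := fun k => ((kap1 k : ℚ) : ℝ) * w r 1 k with hf
  have hS : HasSum f (3 * profile r 1 (1 / 3)) := by
    refine hP.congr_fun fun k => ?_
    simp only [hf, kap1]; push_cast; ring
  have h20 : HasSum (fun n => f (n + 20)) (3 * profile r 1 (1 / 3) - ∑ i ∈ Finset.range 20, f i) := (hasSum_nat_add_iff' 20).mpr hS
  have hhead := (head_functional_bounds hr kap1).2
  have htail : |3 * profile r 1 (1 / 3) - ∑ i ∈ Finset.range 20, f i| ≤ 3 * (((headKQ 20 : ℚ) : ℝ) + ((tailGQ : ℚ) : ℝ)) := by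
    have h20' : HasSum (fun n => w r 1 (n + 20) * (3 * (1 / 3 : ℝ) ^ (n + 20))) (3 * profile r 1 (1 / 3) - ∑ i ∈ Finset.range 20, f i) := by
      refine h20.congr_fun fun n => ?_
      simp only [hf, kap1]; push_cast; ring
    refine abs_tail_le hr (K := 20) (by norm_num) (by norm_num : (0 : ℝ) ≤ 1 / 3) (by norm_num) (u := fun k => 3 * (1 / 3 : ℝ) ^ k) (fun k => ?_) h20'
    rw [abs_of_nonneg (by positivity)]
  have hbud : (((3 * (headKQ 20 + tailGQ) : ℚ)) : ℝ) ≤ (((1 / 20000 : ℚ)) : ℝ) := by exact_mod_cast signs_budget_ok.2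
  have hfun : (((highQ kap1 + 1 / 10000 : ℚ)) : ℝ) ≤ (((147 / 50 : ℚ)) : ℝ) := by exact_mod_cast functionals_ok.1
  push_cast at hbud hfun
  have := (abs_le.mp htail).2
  simp only [hf] at hhead this
  linarith

/-- **The trajectory starts above the barrier line**: `2.4𝒲(1/3) − 3𝒲(−1/3) + 227/250 ≥ 3/100`.
[cite: BuckmasterCaolaboraGomezserrano2025, Prop. 2.5, App. B] -/
theorem line_gap_pos (hr : r ∈ Set.Icc ((13890041/12500000 : ℚ) : ℝ) ((697/625 : ℚ) : ℝ)) :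
    3 / 100 ≤ 12 / 5 * profile r 1 (1 / 3) - 3 * profile r 1 (-(1 / 3)) + 227 / 250 := by
  have hμ : (0 : ℝ) < 73 / 25 := by norm_num
  have hKw := abs_w_le_one_mul_pow hr
  have hζa : (73 / 25 : ℝ) * |(1 / 3 : ℝ)| < 1 := by rw [abs_of_pos (by norm_num)]; norm_num
  have hζb : (73 / 25 : ℝ) * |(-(1 / 3) : ℝ)| < 1 := by rw [abs_neg, abs_of_pos (by norm_num)]; norm_num
  have hP := hasSum_profile_of_bound hμ hKw hζa
  have hN₀ := hasSum_profile_of_bound hμ hKw hζb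
  have hN : HasSum (fun n => w r 1 n * ((-1 : ℝ) ^ n * (1 / 3 : ℝ) ^ n)) (profile r 1 (-(1 / 3))) :=
    hN₀.congr_fun fun n => by rw [neg_pow (1 / 3 : ℝ) n]
  set f : ℕ → ℝ := fun k => ((kap2 k : ℚ) : ℝ) * w r 1 k with hf
  have hS : HasSum f (12 / 5 * profile r 1 (1 / 3) - 3 * profile r 1 (-(1 / 3))) := by
    refine ((hP.mul_left (12 / 5)).sub (hN.mul_left 3)).congr_fun fun k => ?_
    simp only [hf, kap2]; push_cast
    ring
  have h20 : HasSum (fun n => f (n + 20)) (12 / 5 * profile r 1 (1 / 3) - 3 * profile r 1 (-(1 / 3)) - ∑ i ∈ Finset.range 20, f i) :=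
    (hasSum_nat_add_iff' 20).mpr hS
  have hhead := (head_functional_bounds hr kap2).1
  -- tail, rescaled by 5/9 so that `|u_k| ≤ 3 ζ^k`
  have htail : |5 / 9 * (12 / 5 * profile r 1 (1 / 3) - 3 * profile r 1 (-(1 / 3)) - ∑ i ∈ Finset.range 20, f i)|
      ≤ 3 * (((headKQ 20 : ℚ) : ℝ) + ((tailGQ : ℚ) : ℝ)) := by
    have h20' : HasSum (fun n => w r 1 (n + 20) * (5 / 9 * ((12 / 5 - 3 * (-1 : ℝ) ^ (n + 20)) * (1 / 3 : ℝ) ^ (n + 20))))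
        (5 / 9 * (12 / 5 * profile r 1 (1 / 3) - 3 * profile r 1 (-(1 / 3)) - ∑ i ∈ Finset.range 20, f i)) := by
      refine (h20.mul_left (5 / 9)).congr_fun fun n => ?_
      simp only [hf, kap2]; push_cast; ring
    refine abs_tail_le hr (K := 20) (by norm_num) (by norm_num : (0 : ℝ) ≤ 1 / 3) (by norm_num)
      (u := fun k => 5 / 9 * ((12 / 5 - 3 * (-1 : ℝ) ^ k) * (1 / 3 : ℝ) ^ k)) (fun k => ?_) h20'
    rw [abs_mul, abs_mul, abs_of_pos (by norm_num : (0 : ℝ) < 5 / 9), abs_pow, abs_of_pos (by norm_num : (0 : ℝ) < 1 / 3)]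
    have : |12 / 5 - 3 * (-1 : ℝ) ^ k| ≤ 27 / 5 := by
      rcases neg_one_pow_eq_or ℝ k with h | h <;> rw [h] <;> norm_num [abs_of_pos, abs_of_neg]
    have hp : (0 : ℝ) ≤ (1 / 3 : ℝ) ^ k := by positivity
    nlinarith
  have hbud : (((3 * (headKQ 20 + tailGQ) : ℚ)) : ℝ) ≤ (((1 / 20000 : ℚ)) : ℝ) := by exact_mod_cast signs_budget_ok.2
  have hfun : (((3 / 100 + 1 / 10000 : ℚ)) : ℝ) ≤ (((lowQ kap2 + 227 / 250 : ℚ)) : ℝ) := by exact_mod_cast functionals_ok.2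
  push_cast at hbud hfun
  have := (abs_le.mp htail).1
  simp only [hf] at hhead this
  linarith

end CentreW2

end OriginSeries

namespace Monatomic

open OriginSeries OriginSeries.CentreW2 Germ Shooting

set_option linter.style.longLine false

variable {r : ℝ}

/-! ### The barrier line and the speed bound (polynomial inequalities) -/

/-- The barrier line `β(w) = −227/250 − (4/5)w`. [folklore] -/
def βline (w : ℝ) : ℝ := -(227 / 250) - 4 / 5 * w

/-- The crossing quantity of the line is negative on the strip `9/4 ≤ w ≤ 59/20` (window 2).
[cite: BuckmasterCaolaboraGomezserrano2025, Prop. 4.1] -/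
theorem gfun_line_neg {w : ℝ} (hr2 : r ≤ 697 / 625) (hw1 : (9 / 4 : ℝ) ≤ w)
    (hw2 : w ≤ 59 / 20) : Gfun r w (βline w) (-(4 / 5)) < 0 := by
  unfold Gfun NZ NW DW DZ βline
  nlinarith [mul_nonneg (sub_nonneg.2 hw1) (sub_nonneg.2 hw2), mul_nonneg (sub_nonneg.2 hr2) (sub_nonneg.2 hw2),
    mul_nonneg (mul_nonneg (sub_nonneg.2 hw1) (sub_nonneg.2 hw2)) (sub_nonneg.2 hw1),
    mul_nonneg (mul_nonneg (sub_nonneg.2 hw1) (sub_nonneg.2 hw2)) (sub_nonneg.2 hw2)]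

/-- Speed bound at the lower edge of the region. [cite: BuckmasterCaolaboraGomezserrano2025, §6] -/
theorem speed_line {w : ℝ} (hr1 : (13890041 / 12500000 : ℝ) ≤ r) (hw1 : (9 / 4 : ℝ) ≤ w) :
    43 / 20 * DW w (βline w) ≤ -NW r w (βline w) := by
  unfold NW DW βline
  nlinarith [mul_nonneg (sub_nonneg.2 hr1) (sub_nonneg.2 hw1)]

/-- Speed bound at the sonic edge of the region. [cite: BuckmasterCaolaboraGomezserrano2025, §6] -/
theorem speed_sonic {w : ℝ} (hr1 : (13890041 / 12500000 : ℝ) ≤ r) (hw1 : (9 / 4 : ℝ) ≤ w) :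
    43 / 20 * DW w (-(3 + w) / 2) ≤ -NW r w (-(3 + w) / 2) := by
  unfold NW DW
  nlinarith [mul_nonneg (sub_nonneg.2 hr1) (sub_nonneg.2 hw1)]

/-- **Speed bound on the region** `β(w) ≤ Z ≤ −(3+w)/2`, `9/4 ≤ w ≤ 147/50`: `−N_W ≥ (43/20)·D_W` (concavity in `Z`).
[cite: BuckmasterCaolaboraGomezserrano2025, §6] -/
theorem speed_region {w Z : ℝ} (hr1 : (13890041 / 12500000 : ℝ) ≤ r) (hw1 : (9 / 4 : ℝ) ≤ w)
    (hz1 : βline w ≤ Z) (hz2 : Z ≤ -(3 + w) / 2) : 43 / 20 * DW w Z ≤ -NW r w Z := by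
  have h1 := speed_line hr1 hw1
  have h2 := speed_sonic hr1 hw1
  set z1 := βline w with hz1def
  set z2 := -(3 + w) / 2 with hz2def
  set f : ℝ → ℝ := fun Z => -NW r w Z - 43 / 20 * DW w Z with hf
  have hf1 : 0 ≤ f z1 := by simp only [hf]; linarith
  have hf2 : 0 ≤ f z2 := by simp only [hf]; linarith
  have hgap : 0 < z2 - z1 := by rw [hz1def, hz2def]; unfold βline; linarith
  -- concave quadratic: `f Z (z2 - z1) = (z2 - Z) f z1 + (Z - z1) f z2 + (1/6)(Z - z1)(z2 - Z)(z2 - z1)`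
  have key : f Z * (z2 - z1) = (z2 - Z) * f z1 + (Z - z1) * f z2 + 1 / 6 * (Z - z1) * (z2 - Z) * (z2 - z1) := by
    simp only [hf]; unfold NW DW; ring
  have hprod : 0 ≤ 1 / 6 * (Z - z1) * (z2 - Z) * (z2 - z1) := by
    have := mul_nonneg (sub_nonneg.2 hz1) (sub_nonneg.2 hz2)
    positivity
  have hfZ : 0 ≤ f Z * (z2 - z1) := by
    rw [key]
    have := mul_nonneg (sub_nonneg.2 hz2) hf1
    have := mul_nonneg (sub_nonneg.2 hz1) hf2
    linarith
  have : 0 ≤ f Z := nonneg_of_mul_nonneg_left hfZ hgap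
  simp only [hf] at this
  linarith

/-! ### A graph barrier on a strip (smooth graph, `W` bounded on both sides) -/

/-- **Lower graph barrier on a strip** (the smooth case of `graph_le_snd_of_barrier`, with an upper bound on `W`): a solution
of (1.8) in `Ω = {D_W > 0 > D_Z}` with `wlo < W < whi` cannot cross downwards a `C¹` graph whose crossing quantity is negative
on the strip. [cite: BuckmasterCaolaboraGomezserrano2025, Prop. 4.1, Prop. 4.2] -/
theorem graph_le_snd_of_barrier_strip {c : ℝ → ℝ × ℝ} {a T wlo whi m : ℝ} {β : ℝ → ℝ}
    (hc : ∀ ξ ∈ Ico a T, HasDerivAt c (field r (c ξ)) ξ)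
    (hΩ : ∀ ξ ∈ Ico a T, 0 < DW (c ξ).1 (c ξ).2 ∧ DZ (c ξ).1 (c ξ).2 < 0)
    (hrange : ∀ ξ ∈ Ico a T, wlo < (c ξ).1 ∧ (c ξ).1 < whi)
    (hβ : ∀ w, HasDerivAt β m w)
    (hG : ∀ w, wlo < w → w < whi → Gfun r w (β w) m < 0)
    (h0 : β (c a).1 ≤ (c a).2) :
    ∀ ξ ∈ Ico a T, β (c ξ).1 ≤ (c ξ).2 := by
  -- adapted from `graph_le_snd_of_barrier` (smooth points only)
  have hβc : Continuous β := continuous_iff_continuousAt.mpr fun w => (hβ w).continuousAt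
  set g : ℝ → ℝ := fun s => β (c s).1 - (c s).2 with hg
  have hcont : ∀ x ∈ Ico a T, ContinuousAt g x := fun x hx =>
    (hβc.continuousAt.comp (hc x hx).continuousAt.fst).sub (hc x hx).continuousAt.snd
  have hg0 : g a ≤ 0 := by simp only [hg]; linarith
  suffices h : ∀ ξ ∈ Ico a T, g ξ ≤ 0 by
    intro ξ hξ; have := h ξ hξ; simp only [hg] at this; linarith
  refine forall_le_zero_of_local hcont hg0 fun x hx hgx => ?_
  have hcx := hc x hx
  obtain ⟨hDW, hDZ⟩ := hΩ x hx
  have hZx : (c x).2 = β (c x).1 := by simp only [hg] at hgx; linarith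
  have hneg : DW (c x).1 (c x).2 * DZ (c x).1 (c x).2 < 0 := mul_neg_of_pos_of_neg hDW hDZ
  have hGx := hG _ (hrange x hx).1 (hrange x hx).2
  have hgd : HasDerivAt g (-((field r (c x)).2 - m * (field r (c x)).1)) x :=
    (hasDerivAt_snd_sub_graph hcx (hβ _)).neg.congr_of_eventuallyEq
      (Filter.Eventually.of_forall fun s => by
        show β (c s).1 - (c s).2 = -((c s).2 - β (c s).1); ring)
  have hval : -((field r (c x)).2 - m * (field r (c x)).1) < 0 := by
    have e := field_snd_sub_mul_fst (r := r) (m := m) hDW.ne' hDZ.ne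
    rw [show ((c x).1, (c x).2) = c x from rfl] at e
    rw [e, hZx]
    rw [hZx] at hneg
    have : 0 < Gfun r (c x).1 (β (c x).1) m / (DW (c x).1 (β (c x).1) * DZ (c x).1 (β (c x).1)) :=
      div_pos_of_neg_of_neg hGx hneg
    linarith
  have hlt := ODE.eventually_lt_of_hasDerivAt_neg hgd hval
  filter_upwards [hlt] with y hy
  rw [hgx] at hy; exact hy.le

/-! ### The arrival time bound -/

/-- `W₀(r) ≥ 451/200` on the window (`r ≤ 697/625`). [cite: BuckmasterCaolaboraGomezserrano2025, §2.1] -/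
theorem W0_ge_window2 (hr2 : r ≤ 697 / 625) : 451 / 200 ≤ W0 r := by
  unfold W0 Monatomic.q disc
  have hd : (r - 149 / 400) ^ 2 ≤ r ^ 2 - 6 * r + 6 := by nlinarith
  have hs : r - 149 / 400 ≤ Real.sqrt (r ^ 2 - 6 * r + 6) := Real.le_sqrt_of_sq_le hd
  linarith

/-- **The `P₀` trajectory is the origin germ up to `e^ξ = 17/50`** (before its arrival time).
[cite: BuckmasterCaolaboraGomezserrano2025, Prop. 2.5, Prop. 1.6] -/
theorem traj_eq_germ_window2 (hr : r ∈ Set.Icc ((13890041/12500000 : ℚ) : ℝ) ((697/625 : ℚ) : ℝ)) {ξ : ℝ}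
    (hξ : Real.exp ξ < 17 / 50) (hξb : ξ < bT r) : traj r ξ = germ r ξ := by
  have hr1 : ((13890041 / 12500000 : ℚ) : ℝ) ≤ r := hr.1
  have hr2 : r ≤ ((697 / 625 : ℚ) : ℝ) := hr.2
  push_cast at hr1 hr2
  have h1 : (11 / 10 : ℝ) ≤ r := by linarith [hr1]
  have h2 : r ≤ 28 / 25 := by linarith [hr2]
  obtain ⟨hA, hgermA, hode, hsig, -, -, -⟩ := traj_spec h1 h2
  -- interval `(ξA - 2, b₁)`, `b₁ = min (bT r) (log (17/50))`
  set b₁ : ℝ := min (bT r) (Real.log (17 / 50)) with hb₁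
  have hξb₁ : ξ < b₁ := lt_min hξb (by rw [Real.lt_log_iff_exp_lt (by norm_num)]; exact hξ)
  have hexp : ∀ t, t < b₁ → Real.exp t ≤ 17 / 50 := by
    intro t ht
    have : t < Real.log (17 / 50) := ht.trans_le (min_le_right _ _)
    rw [Real.lt_log_iff_exp_lt (by norm_num)] at this
    exact this.le
  set a : ℝ := min (ξA - 2) (ξ - 1) with ha
  have hξa : a < ξ := (min_le_right _ _).trans_lt (by linarith)
  have ht₀ : ξA - 1 ∈ Ioo a b₁ := by
    refine ⟨(min_le_left _ _).trans_lt (by linarith), lt_min hA ?_⟩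
    rw [Real.lt_log_iff_exp_lt (by norm_num)]
    exact (exp_lt_of_le (show ξA - 1 ≤ ξA by norm_num)).trans (by norm_num)
  have key := eqOn_of_field (r := r) (c₁ := germ r) (c₂ := traj r) (a := a) (b := b₁) ht₀
    (fun t ht => germ_hasDerivAt_window2 hr (hexp t ht.2))
    (fun t ht => hode t (ht.2.trans_le (min_le_left _ _)))
    (fun t ht => ⟨(germ_signs_window2 hr (hexp t ht.2)).1.ne', (germ_signs_window2 hr (hexp t ht.2)).2.ne⟩)
    (hgermA (ξA - 1) le_rfl).symm
  exact (key ⟨hξa, hξb₁⟩).symm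

/-- **Arrival time bound**: `bT r ≤ log(1/3) + 137/430` on the window (so the sonic scale `e^{bT r} ≤ 0.4584`).
[cite: BuckmasterCaolaboraGomezserrano2025, Prop. 2.5, Prop. 4.1, §6] -/
theorem bT_le_window2 (hr : r ∈ Set.Icc ((13890041/12500000 : ℚ) : ℝ) ((697/625 : ℚ) : ℝ)) :
    bT r ≤ Real.log (1 / 3) + 137 / 430 := by
  have hr1 : ((13890041 / 12500000 : ℚ) : ℝ) ≤ r := hr.1
  have hr2 : r ≤ ((697 / 625 : ℚ) : ℝ) := hr.2
  push_cast at hr1 hr2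
  have h1 : (11 / 10 : ℝ) ≤ r := by linarith
  have h2 : r ≤ 28 / 25 := by linarith
  obtain ⟨hA, hgermA, hode, hsig, hNW, hanti, htend⟩ := traj_spec h1 h2
  refine le_of_not_gt fun hlt => ?_
  set ξ₁ : ℝ := Real.log (1 / 3) with hξ₁
  have he1 : Real.exp ξ₁ = 1 / 3 := by rw [hξ₁, Real.exp_log (by norm_num)]
  have he1' : Real.exp (-ξ₁) = 3 := by rw [Real.exp_neg, he1]; norm_num
  have hξ₁b : ξ₁ < bT r := by linarith
  -- the state at `ξ₁`
  have hgerm₁ : traj r ξ₁ = germ r ξ₁ := traj_eq_germ_window2 hr (by rw [he1]; norm_num) hξ₁b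
  have hW₁ : (traj r ξ₁).1 = 3 * profile r 1 (1 / 3) := by rw [hgerm₁, germ_fst, he1, he1']
  have hZ₁ : (traj r ξ₁).2 = -(3 * profile r 1 (-(1 / 3))) := by rw [hgerm₁, germ_snd, he1, he1']; ring
  have hW₁le : (traj r ξ₁).1 ≤ 147 / 50 := by rw [hW₁]; exact W1_le hr
  have hline₁ : βline (traj r ξ₁).1 ≤ (traj r ξ₁).2 := by
    rw [hW₁, hZ₁]; unfold βline
    have := line_gap_pos hr
    linarith
  have hW0 := W0_ge_window2 hr2
  -- `W` stays in `(9/4, 59/20)` on `[ξ₁, bT)`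
  have hrange : ∀ ξ ∈ Ico ξ₁ (bT r), (9 / 4 : ℝ) < (traj r ξ).1 ∧ (traj r ξ).1 < 59 / 20 := by
    intro ξ hξ
    constructor
    · have := W0_lt_traj h1 h2 hξ.2; linarith
    · have hle : (traj r ξ).1 ≤ (traj r ξ₁).1 := hanti.antitoneOn hξ₁b hξ.2 hξ.1
      linarith
  -- the barrier: `Z ≥ β(W)` on `[ξ₁, bT)`
  have hbar := graph_le_snd_of_barrier_strip (r := r) (c := traj r) (a := ξ₁) (T := bT r) (wlo := 9 / 4) (whi := 59 / 20)
    (m := -(4 / 5)) (β := βline)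
    (fun ξ hξ => hode ξ hξ.2) (fun ξ hξ => ⟨(hsig ξ hξ.2).1, (hsig ξ hξ.2).2.1⟩) hrange
    (fun w => by
      unfold βline
      exact (((hasDerivAt_id w).const_mul (4 / 5 : ℝ)).const_sub (-(227 / 250) : ℝ)).congr_deriv (by simp))
    (fun w hw1 hw2 => gfun_line_neg hr2 hw1.le hw2.le) hline₁
  -- the speed bound `W′ ≤ -43/20` on `(ξ₁, bT)`
  have hderiv : ∀ ξ ∈ Ioo ξ₁ (bT r), HasDerivAt (fun s => (traj r s).1) ((field r (traj r ξ)).1) ξ :=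
    fun ξ hξ => (hode ξ hξ.2).fst
  have hspeed : ∀ ξ ∈ Ioo ξ₁ (bT r), (field r (traj r ξ)).1 ≤ -(43 / 20) := by
    intro ξ hξ
    obtain ⟨hDW, hDZ, -⟩ := hsig ξ hξ.2
    have hw := hrange ξ ⟨hξ.1.le, hξ.2⟩
    have hz1 := hbar ξ ⟨hξ.1.le, hξ.2⟩
    have hz2 : (traj r ξ).2 ≤ -(3 + (traj r ξ).1) / 2 := by unfold DZ at hDZ; linarith
    have hsp := speed_region hr1 hw.1.le hz1 hz2
    show NW r (traj r ξ).1 (traj r ξ).2 / DW (traj r ξ).1 (traj r ξ).2 ≤ -(43 / 20)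
    rw [div_le_iff₀ hDW]; linarith
  -- mean value theorem on `[ξ₁, b]`, `b = ξ₁ + 137/430 < bT`
  set b : ℝ := ξ₁ + 137 / 430 with hb
  have hbT : b < bT r := by rw [hb]; linarith
  have hcont : ContinuousOn (fun s => (traj r s).1) (Icc ξ₁ b) := fun s hs =>
    (hode s (lt_of_le_of_lt hs.2 hbT)).continuousAt.fst.continuousWithinAt
  obtain ⟨θ, hθ, hslope⟩ := exists_hasDerivAt_eq_slope (fun s => (traj r s).1) (fun s => (field r (traj r s)).1)
    (by rw [hb]; linarith) hcont (fun s hs => hderiv s ⟨hs.1, hs.2.trans hbT⟩)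
  have hθ' : (field r (traj r θ)).1 ≤ -(43 / 20) := hspeed θ ⟨hθ.1, hθ.2.trans hbT⟩
  rw [hslope, div_le_iff₀ (by rw [hb]; norm_num)] at hθ'
  have hWb : 451 / 200 < (traj r b).1 := by have := W0_lt_traj h1 h2 hbT; linarith
  rw [hb] at hθ' hWb
  norm_num at hθ' hWb
  linarith

/-- The sonic scale bound: `e^{bT r} ≤ 23/50`. [cite: BuckmasterCaolaboraGomezserrano2025, §6] -/
theorem exp_bT_le_window2 (hr : r ∈ Set.Icc ((13890041/12500000 : ℚ) : ℝ) ((697/625 : ℚ) : ℝ)) :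
    Real.exp (bT r) ≤ 23 / 50 := by
  have h := bT_le_window2 hr
  have hexp : Real.exp (137 / 430 : ℝ) ≤ 69 / 50 := by
    have hb := Real.exp_bound (x := (137 / 430 : ℝ)) (by rw [abs_of_pos (by norm_num)]; norm_num) (n := 4) (by norm_num)
    have hs : ∑ m ∈ Finset.range 4, (137 / 430 : ℝ) ^ m / (m.factorial : ℝ) = 1 + 137 / 430 + (137 / 430) ^ 2 / 2 + (137 / 430) ^ 3 / 6 := by
      norm_num [Finset.sum_range_succ, Nat.factorial]
    rw [hs, abs_of_pos (by norm_num : (0 : ℝ) < 137 / 430)] at hb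
    have := (abs_le.mp hb).2
    norm_num [Nat.factorial] at this ⊢
    linarith
  calc Real.exp (bT r) ≤ Real.exp (Real.log (1 / 3) + 137 / 430) := Real.exp_le_exp.mpr h
    _ = 1 / 3 * Real.exp (137 / 430) := by rw [Real.exp_add, Real.exp_log (by norm_num)]
    _ ≤ 23 / 50 := by linarith

end Monatomic

end BuckmasterCaolaboraGomezserrano2025

end Literature.Analysis.FluidPDE
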